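import Summits.ResolutionOfSingularities.ResolutionOfSingularities.Theorems.WeightedInvariantWeightedConstructionStaticDefs
import Summits.ResolutionOfSingularities.ResolutionOfSingularities.Theorems.WeightedInvariantWeightedConstructionVertexPrimes
import Summits.ResolutionOfSingularities.ResolutionOfSingularities.Theorems.WeightedInvariantWeightedConstructionFullBlowupOffExceptional
import Summits.ResolutionOfSingularities.ResolutionOfSingularities.Theorems.WeightedInvariantWeightedConstructionFullBlowupRegime
import Summits.ResolutionOfSingularities.ResolutionOfSingularities.Theorems.WeightedInvariantWeightedConstructionExceptionalPrincipal
import Literature.AlgebraicGeometry.Resolution.IdealSheafLemmas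

/-!
# Static levers: what `(usc) + (i) + (R)` force on a static pre-datum (degeneration monotonicity)

Route `ResolutionOfSingularities/WeightedInvariant`, crux `WeightedConstruction`
(stmt-ResolutionOfSingularities-0571, `∀ p prime, Nonempty (WeightedResolutionDatum p)`), line
`no-phi-rays-static-drop` (lead c3). The transfer stub of the line asks for a `StaticPreDatum p`
(Theorems/…StaticDefs.lean): the datum interface with the drop axiom `(iv)` replaced by RESTRICTION
`(R)` and the cone drop `(CI)`. This file records D-free consequences of the static axioms that every
construction must respect and every refutation may use:

* `stub_inv_mono_of_specializes` — `(usc)` ⇒ the rating does not decrease under specialisation;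
* `StaticPreDatum.inv_le_inv_exceptional_vertex` — **degeneration monotonicity / vertex domination**:
  for ANY Rees algebra `R` on `Y` with a weighted chart on the affine open `U` (not necessarily the
  datum's own centre) and any point `y ∈ U` of the support of `R`, the rating of the EXCEPTIONAL-FIBRE
  PAIR `(V(t⁻¹) ⊆ B(U), σˢ(X)|_{V(t⁻¹)})` of the FULL cobordant blow-up `B(U) = Spec Γ(U)[t⁻¹, Rₙ(U)tⁿ]`
  (Włodarczyk, arXiv:2203.03090, Def. 2.3.5; `V(t⁻¹) = Spec gr_R = ` the full weighted normal cone,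
  Lemma 4.1.5, carrying the initial ideal of `X`, Lemma 4.1.7 = tree `stub_initialIdeal`) at the VERTEX
  POINT over `y` is `≥` the rating of `(Y, X)` at `y`. Proof: the generic point `ξ` of the vertex line
  over `y` lies off `V(t⁻¹)`, where `B(U)` is `U × 𝔾ₘ` with the total transform, so the rating there is
  the rating at `y` (`stub_fullBlowup_offExceptional`, functoriality `(i)`); `ξ` specialises to the
  vertex point `𝔟` on `V(t⁻¹)` (`stub_vertexPrimes`), so the rating at `𝔟` is `≥` (`(usc)`); and `V(t⁻¹)`
  is a smooth hypersurface of the smooth `B(U)` (`stub_fullBlowup_regime`) with the `σˢ(X)`-regular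
  equation `t⁻¹` (the strict transform is `t⁻¹`-saturated), so `(R)` restricts to it.

Read together with `(CI)` (which bounds the rating on the PUNCTURED cone `E(U) = V(t⁻¹) ∩ B₊(U)` of the
datum's own centre strictly below `max_Y`), this says: on the full cone pair of its own centre the vertex
section is exactly the maximum locus — the static form of "no Φ-ray", and the lever by which every
candidate centre of a construction can be tested without blowing up.
-/

noncomputable section

open CategoryTheory AlgebraicGeometry TopologicalSpace
open Literature.AlgebraicGeometry.Resolution
open scoped LaurentPolynomial

set_option linter.dupNamespace false -- mandated namespace of this single-conjunct summit

namespace Summit.ResolutionOfSingularities.ResolutionOfSingularities.Theorems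

/-- **`(usc)` ⇒ monotonicity under specialisation**: the rating of a static pre-datum does not
decrease when passing from a point to a specialisation of it (superlevel sets are closed, and closed
sets are stable under specialisation). [folklore] -/
theorem stub_inv_mono_of_specializes :
    ∀ {p : ℕ} (S : StaticPreDatum p) ⦃k : Type⦄ [Field k] [CharP k p] [PerfectField k]
      ⦃Y : Scheme.{0}⦄ (f : Y ⟶ Spec (.of k)) [Smooth f] [IsSeparated f] [QuasiCompact f]
      (X : Y.IdealSheafData) (y y' : Y), y ⤳ y' → S.inv f X y ≤ S.inv f X y' := by
  intro p S k _ _ _ Y f _ _ _ X y y' h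
  exact h.mem_closed (S.isClosed_superlevel f X (S.inv f X y)) le_rfl

/-- **The exceptional divisor `V(t⁻¹)` of the full cobordant blow-up is principal with a
strict-transform-regular equation** (globally, `B(U)` being affine): its top ideal is generated by
(the transport of) `t⁻¹`, which is a non-zero-divisor modulo the strict transform `σˢ(X(U))`
(Włodarczyk 3.3.12: `σˢ` is the `t⁻¹`-saturation). [cite: Wlodarczyk2022, 3.3.12] -/
theorem exceptional_principal_regular_top {A : Type} [CommRing A] (I : ℕ → Ideal A) (𝔞 : Ideal A)
    (x : (affineCobordantBlowup.exceptional I).subscheme) :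
    ∃ V : (affineCobordantBlowup I).affineOpens,
      (affineCobordantBlowup.exceptional I).subschemeι x ∈ (V : (affineCobordantBlowup I).Opens) ∧
      ∃ h : Γ(affineCobordantBlowup I, V),
        (affineCobordantBlowup.exceptional I).ideal V = Ideal.span {h} ∧
        ∀ a : Γ(affineCobordantBlowup I, V),
          h * a ∈ (affineCobordantBlowup.idealSheaf I (extReesAlgebra.strictTransform I 𝔞)).ideal V →
          a ∈ (affineCobordantBlowup.idealSheaf I (extReesAlgebra.strictTransform I 𝔞)).ideal V := by
  haveI : IsAffine (affineCobordantBlowup I) := by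
    unfold affineCobordantBlowup
    infer_instance
  set eΓ := Scheme.ΓSpecIso (.of (extReesAlgebra I))
  refine ⟨⟨⊤, isAffineOpen_top _⟩, trivial, eΓ.inv (extReesAlgebra.tInv I), ?_, ?_⟩
  · rw [affineCobordantBlowup.exceptional, affineCobordantBlowup.idealSheaf, ideal_ofIdealTop_top,
      Ideal.map_span, Set.image_singleton]
    rfl
  · intro a ha
    rw [affineCobordantBlowup.idealSheaf, ideal_ofIdealTop_top] at ha ⊢
    exact ExceptionalPrincipal.mem_map_of_mul_mem_map_of_inverse eΓ.inv.hom eΓ.hom.hom (CommRingCat.hom_inv_apply eΓ)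
      (CommRingCat.inv_hom_apply eΓ) (fun g hg => ExceptionalPrincipal.mem_strictTransform_of_tInv_mul_mem I hg) a ha

namespace StaticPreDatum

variable {p : ℕ} (S : StaticPreDatum p)

/-- **Degeneration monotonicity (vertex domination).** For a static pre-datum `S`, a pair `(Y, X)` in
the regime, ANY Rees algebra `R` on `Y` with a weighted chart on the affine open `U`, and a point
`y ∈ U` of the support of `R`: the vertex point `𝔟` of the full cobordant blow-up `B(U)` over `y` lies on
the exceptional divisor `V(t⁻¹)` (the full weighted normal cone), and the rating of the pair
`(V(t⁻¹), σˢ(X)|_{V(t⁻¹)})` there is at least the rating of `(Y, X)` at `y`. (Generic point of the vertex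
line: off `V(t⁻¹)`, rating `= inv y` by `(i)`; it specialises to `𝔟`: `(usc)`; restrict to the smooth
`t⁻¹`-regular hypersurface `V(t⁻¹)`: `(R)`.) [cite: Wlodarczyk2022, Def. 2.3.5 and Lemma 4.1.5] -/
theorem inv_le_inv_exceptional_vertex {k : Type} [Field k] [CharP k p] [PerfectField k]
    {Y : Scheme.{0}} (f : Y ⟶ Spec (.of k)) [Smooth f] [IsSeparated f] [QuasiCompact f]
    (X : Y.IdealSheafData) (R : ReesAlgebraData Y) (U : Y.affineOpens)
    (hchart : ∃ (m : ℕ) (u : Fin m → Γ(Y, U)) (w : Fin m → ℕ), R.IsWeightedChart U u w)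
    (y : Y) (hyU : y ∈ (U : Y.Opens)) (hy : y ∈ R.support) :
    ∃ e : (affineCobordantBlowup.exceptional (R.chartIdeals U)).subscheme,
      ((affineCobordantBlowup.exceptional (R.chartIdeals U)).subschemeι ≫
          affineCobordantBlowup.π (R.chartIdeals U) ≫ U.2.fromSpec) e = y ∧
      (affineCobordantBlowup.exceptional (R.chartIdeals U)).subschemeι e ∈
        ((affineCobordantBlowup.vertex (R.chartIdeals U)).support :
          Set (affineCobordantBlowup (R.chartIdeals U))) ∧
      S.inv f X y ≤
        S.inv ((affineCobordantBlowup.exceptional (R.chartIdeals U)).subschemeι ≫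
            affineCobordantBlowup.π (R.chartIdeals U) ≫ U.2.fromSpec ≫ f)
          ((affineCobordantBlowup.idealSheaf (R.chartIdeals U)
              (extReesAlgebra.strictTransform (R.chartIdeals U) (X.ideal U))).comap
            (affineCobordantBlowup.exceptional (R.chartIdeals U)).subschemeι) e := by
  classical
  -- the point `y` as a prime `q` of `Γ(Y, U)`, containing every piece `Rₙ(U)`, `n ≥ 1`
  let q : Spec Γ(Y, U) := U.2.primeIdealOf ⟨y, hyU⟩
  have hq : U.2.fromSpec q = y := U.2.fromSpec_primeIdealOf ⟨y, hyU⟩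
  have hIP : ∀ n : ℕ, 0 < n → R.chartIdeals U n ≤ q.asIdeal := by
    intro n hn a ha
    have h1 := (R.mem_support_iff.mp hy) n hn
    have hqU : U.2.fromSpec q ∈ (U : Y.Opens) := by rw [hq]; exact hyU
    rw [← hq, Scheme.IdealSheafData.mem_support_iff_of_mem hqU] at h1
    have h2 : q ∈ U.2.fromSpec ⁻¹' Y.zeroLocus (U := U) ((R.piece n).ideal U) := h1
    rw [U.2.fromSpec_preimage_zeroLocus] at h2
    exact h2 ha
  -- the generic point `ξ` of the vertex line over `q` and the vertex point `𝔟`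
  obtain ⟨ξ, 𝔟, hsp, hξs, h𝔟s, hvert, hξP, h𝔟P⟩ := stub_vertexPrimes (R.chartIdeals U) q.asIdeal hIP
  -- both lie over `y`
  have hover : ∀ z : affineCobordantBlowup (R.chartIdeals U),
      z.asIdeal.comap (algebraMap Γ(Y, U) (extReesAlgebra (R.chartIdeals U))) = q.asIdeal →
      (affineCobordantBlowup.π (R.chartIdeals U) ≫ U.2.fromSpec) z = y := by
    intro z hz
    have hπ : affineCobordantBlowup.π (R.chartIdeals U) z = q := by
      apply PrimeSpectrum.ext
      change Ideal.comap _ z.asIdeal = q.asIdeal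
      exact hz
    rw [Scheme.Hom.comp_apply, hπ, hq]
  -- the regime of `B(U) → Spec k` and `V(t⁻¹) → Spec k`
  obtain ⟨hBsm, hBsep, hBqc, hEsm, -, -⟩ := stub_fullBlowup_regime f R U hchart
  haveI := hBsm
  haveI := hBsep
  haveI := hBqc
  -- off `V(t⁻¹)`: the rating at `ξ` is the rating at `y`
  have hξE : ξ ∉ ((affineCobordantBlowup.exceptional (R.chartIdeals U)).support :
      Set (affineCobordantBlowup (R.chartIdeals U))) :=
    (OffExceptional.not_mem_support_exceptional_iff (R.chartIdeals U) ξ).mpr hξs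
  have h1 := stub_fullBlowup_offExceptional p S.Γ S.inv S.inv_comap f X R U hBsm hBsep hBqc ξ hξE
  rw [hover ξ hξP] at h1
  -- `ξ ⤳ 𝔟`: the rating at `𝔟` is at least that at `ξ`
  have h2 := stub_inv_mono_of_specializes S
    (affineCobordantBlowup.π (R.chartIdeals U) ≫ U.2.fromSpec ≫ f)
    (affineCobordantBlowup.idealSheaf (R.chartIdeals U)
      (extReesAlgebra.strictTransform (R.chartIdeals U) (X.ideal U))) ξ 𝔟 hsp
  -- `𝔟` lies on `V(t⁻¹)`: it is a point `e` of the closed subscheme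
  have h𝔟E : 𝔟 ∈ ((affineCobordantBlowup.exceptional (R.chartIdeals U)).support :
      Set (affineCobordantBlowup (R.chartIdeals U))) := by
    by_contra h
    exact ((OffExceptional.not_mem_support_exceptional_iff (R.chartIdeals U) 𝔟).mp h) h𝔟s
  obtain ⟨e, he⟩ : ∃ e : (affineCobordantBlowup.exceptional (R.chartIdeals U)).subscheme,
      (affineCobordantBlowup.exceptional (R.chartIdeals U)).subschemeι e = 𝔟 := by
    rw [← Scheme.IdealSheafData.range_subschemeι] at h𝔟E
    exact h𝔟E
  -- `(R)`: restrict to the smooth, principal, `σˢ(X)`-regular hypersurface `V(t⁻¹)`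
  have h3 := S.inv_le_restrict (affineCobordantBlowup.π (R.chartIdeals U) ≫ U.2.fromSpec ≫ f)
    (affineCobordantBlowup.idealSheaf (R.chartIdeals U)
      (extReesAlgebra.strictTransform (R.chartIdeals U) (X.ideal U)))
    (affineCobordantBlowup.exceptional (R.chartIdeals U)) hEsm
    (exceptional_principal_regular_top (R.chartIdeals U) (X.ideal U)) e
  rw [he] at h3
  refine ⟨e, ?_, ?_, h1.symm.le.trans (h2.trans h3)⟩
  · rw [Scheme.Hom.comp_apply, he]
    exact hover 𝔟 h𝔟P
  · rw [he]
    exact (OffExceptional.mem_support_idealSheaf_iff (R.chartIdeals U) _ 𝔟).mpr hvert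

end StaticPreDatum

end Summit.ResolutionOfSingularities.ResolutionOfSingularities.Theorems

end
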